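import Summits.AtomisticToContinuum.BoseEinsteinCondensation.Theorems.BECTwoSectorGDKLSTransfer
import HarnessLib

/-!
# Route `BECTwoSectorGD`: `PeriodicInfraredBound` (stmt-AtomisticToContinuum-12624) is `GaussianDomination` (stmt-12620) alone

With the support item `KLSTransfer` (stmt-AtomisticToContinuum-12622) PROVED (`Theorems.KLSTransfer_proof`,
`Theorems/BECTwoSectorGDKLSTransfer.lean`), the stand-alone periodic T = 0 infrared bound `PeriodicInfraredBound` (stmt-12624,
open-problem strength) follows from two-sector Gaussian domination `GaussianDomination` (stmt-12620) by one line of logic — the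
kernel-checked form of the route's `ir_of_gd`. Supports (does not close) stmt-12624: it records that 12624 carries no content
beyond 12620.
-/

namespace Summit.AtomisticToContinuum.BoseEinsteinCondensation.Theorems

open Summit.AtomisticToContinuum.BoseEinsteinCondensation.Theses.BECTwoSectorGD (GaussianDomination PeriodicInfraredBound)

/-- **`GaussianDomination → PeriodicInfraredBound`** (stmt-12620 ⇒ stmt-12624): two-sector Gaussian domination for every
integrable admissible potential gives the periodic infrared bound with the Kennedy–Lieb–Shastry shape, by the proved transfer
`KLSTransfer_proof`. [folklore] -/
theorem periodicInfraredBound_of_gaussianDomination : GaussianDomination → PeriodicInfraredBound :=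
  fun hGD v hv hint => KLSTransfer_proof v hv hint (hGD v hv hint)

end Summit.AtomisticToContinuum.BoseEinsteinCondensation.Theorems
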